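import Summits.AtomisticToContinuum.HydrodynamicLimit.Theorems.AntiMazurCoboundariesCellForecastPressureDecayClusterTailFreshPairHitStatic
import Summits.AtomisticToContinuum.HydrodynamicLimit.Theorems.AntiMazurCoboundariesCellForecastPressureDecayKinematicAssemblyClusterEnergy
import HarnessLib

/-!
# S2e-3(C) · the short-time cluster tail, T1 piece 3: the mean of the two-body majorant under the cell law
# (sub-goal `stub_clusterTail_freshPairHit_mean` of the registered sub-goal `stub_clusterTail_freshPairHit`
# of stub `stub_clusterTail`, crux line `enskog-compensator-martingale`, crux `CellForecastPressureDecay`,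
# stmt-AtomisticToContinuum-13915)

The probabilistic half of the T1 estimate. For a tagged ordered pair `(i, i.succAbove j')` of the `(m+2)`-sphere cell
law and a mesh `Δ/M`, the two-body majorant `G_M` of the pathwise piece (cylinder indicator of the pair's initial
relative data, times the number of triples (grid time `ℓΔ/M`, bath sphere `c`, tag) whose explicit two-body state of
the tag relative to the time-`ℓΔ/M` state of the sphere `c` of the `m`-sphere flow of the bath lies in the cylinder of
one mesh length) has mean `≤ 156 |S²|² σ⁴ m Δ² L⁻⁶`, uniformly in `M`:

* double insertion (`lintegral_cellLaw_succ_le` twice, piece S2e(C)): the two tagged spheres become uniform on the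
  cube with independent Maxwellian velocities, the bath is dominated by `4 ×` the `m`-sphere cell law;
* the static piece (`stub_clusterTail_freshPairHit_static`) integrates out the two tagged positions:
  `≤ L⁻⁶ σ⁴ Δ (Δ/M) |S²|² ∑_{ℓ<M} ∑_c 2 (‖w₁‖ + ‖w₂‖)(‖w₁‖ + ‖w₂‖ + ‖V_c(ℓΔ/M)‖)`;
* energy conservation of the bath (`stub_kinematicAssembly_clusterEnergy` with `B = univ`):
  `∑_c ‖V_c(t)‖² = ∑_c ‖v_c‖²`, so the double sum is `≤ M (6 m (‖w₁‖² + ‖w₂‖²) + ∑_c ‖v_c‖²)` and the mesh cancels;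
* the mean kinetic energy of the bath is `≤ 3m` (`lintegral_kinetic_cellLaw_le`) and the Maxwellian second moment
  is `3` (`integral_norm_sq_stdGaussian`).

References: Cercignani–Illner–Pulvirenti 1994, §2.2, §4.2; Gallagher–Saint-Raymond–Texier 2013, §4.1; Ruelle 1969,
§4.2 (insertion bound).
-/

noncomputable section

open MeasureTheory ProbabilityTheory Set Filter Topology
open scoped ENNReal BigOperators InnerProductSpace
open Literature.Analysis.FluidPDE Literature.MathematicalPhysics.KineticTheory
open Summit.AtomisticToContinuum.HydrodynamicLimit.Theorems.CellForecastPressureDecay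
  (cellCube measurableSet_cellCube volume_cellCube isProbabilityMeasure_cellLaw)

namespace Summit.AtomisticToContinuum.HydrodynamicLimit.Theorems.EnskogCompensator

/-! ## Real arithmetic: the energy bound of the double sum -/

section Arithmetic

variable {m : ℕ}

/-- `2N(N + v) ≤ 3N² + v²` and `(a + b)² ≤ 2(a² + b²)`: the double sum of the static bound against the energy of the
bath at the grid times. If `∑_c ‖V_{ℓ,c}‖² = E₀` for every `ℓ < M`, then
`(‖w₁‖ + ‖w₂‖) ∑_{ℓ<M} ∑_c 2 σ² (Δ/M) (‖w₁‖ + ‖w₂‖ + ‖V_{ℓ,c}‖) S ≤ σ² Δ S (6 m (‖w₁‖² + ‖w₂‖²) + E₀)`. [folklore] -/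
theorem pair_sum_energy_le {σ Δ Sr E₀ : ℝ} (hΔ : 0 ≤ Δ) (hSr : 0 ≤ Sr) (hE₀ : 0 ≤ E₀) (M : ℕ)
    (V : ℕ → Fin m → V3) (w₁ w₂ : V3) (hE : ∀ ℓ ∈ Finset.range M, ∑ c : Fin m, ‖V ℓ c‖ ^ 2 = E₀) :
    (‖w₁‖ + ‖w₂‖) * ∑ ℓ ∈ Finset.range M, ∑ c : Fin m, 2 * (σ ^ 2 * (Δ / M) * (‖w₁‖ + ‖w₂‖ + ‖V ℓ c‖) * Sr) ≤
      σ ^ 2 * Δ * Sr * (6 * m * (‖w₁‖ ^ 2 + ‖w₂‖ ^ 2) + E₀) := by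
  set N := ‖w₁‖ + ‖w₂‖ with hN
  have hN0 : 0 ≤ N := by positivity
  -- per grid time
  have hℓ : ∀ ℓ ∈ Finset.range M, N * ∑ c : Fin m, 2 * (σ ^ 2 * (Δ / M) * (N + ‖V ℓ c‖) * Sr) ≤
      σ ^ 2 * (Δ / M) * Sr * (6 * m * (‖w₁‖ ^ 2 + ‖w₂‖ ^ 2) + E₀) := by
    intro ℓ hℓ
    rw [← hE ℓ hℓ, Finset.mul_sum]
    have hc : ∀ c : Fin m, N * (2 * (σ ^ 2 * (Δ / M) * (N + ‖V ℓ c‖) * Sr)) ≤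
        σ ^ 2 * (Δ / M) * Sr * (6 * (‖w₁‖ ^ 2 + ‖w₂‖ ^ 2) + ‖V ℓ c‖ ^ 2) := by
      intro c
      have hK : 0 ≤ σ ^ 2 * (Δ / M) * Sr := by positivity
      have h1 : N * (2 * (N + ‖V ℓ c‖)) ≤ 6 * (‖w₁‖ ^ 2 + ‖w₂‖ ^ 2) + ‖V ℓ c‖ ^ 2 := by
        nlinarith [sq_nonneg (N - ‖V ℓ c‖), sq_nonneg (‖w₁‖ - ‖w₂‖), norm_nonneg (V ℓ c)]
      calc N * (2 * (σ ^ 2 * (Δ / M) * (N + ‖V ℓ c‖) * Sr)) = σ ^ 2 * (Δ / M) * Sr * (N * (2 * (N + ‖V ℓ c‖))) := by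
            ring
        _ ≤ σ ^ 2 * (Δ / M) * Sr * (6 * (‖w₁‖ ^ 2 + ‖w₂‖ ^ 2) + ‖V ℓ c‖ ^ 2) := mul_le_mul_of_nonneg_left h1 hK
    calc ∑ c : Fin m, N * (2 * (σ ^ 2 * (Δ / M) * (N + ‖V ℓ c‖) * Sr))
        ≤ ∑ c : Fin m, σ ^ 2 * (Δ / M) * Sr * (6 * (‖w₁‖ ^ 2 + ‖w₂‖ ^ 2) + ‖V ℓ c‖ ^ 2) := Finset.sum_le_sum fun c _
              => hc c
      _ = σ ^ 2 * (Δ / M) * Sr * (6 * m * (‖w₁‖ ^ 2 + ‖w₂‖ ^ 2) + ∑ c : Fin m, ‖V ℓ c‖ ^ 2) := by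
          rw [← Finset.mul_sum, Finset.sum_add_distrib, Finset.sum_const, Finset.card_univ, Fintype.card_fin,
            nsmul_eq_mul]
          ring
  -- sum over the grid: the mesh cancels
  rw [Finset.mul_sum]
  refine (Finset.sum_le_sum hℓ).trans ?_
  rw [Finset.sum_const, Finset.card_range, nsmul_eq_mul]
  rcases Nat.eq_zero_or_pos M with hM | hM
  · subst hM
    simp only [Nat.cast_zero, zero_mul]
    positivity
  · have hM' : (M : ℝ) ≠ 0 := by exact_mod_cast hM.ne'
    rw [show (M : ℝ) * (σ ^ 2 * (Δ / M) * Sr * (6 * m * (‖w₁‖ ^ 2 + ‖w₂‖ ^ 2) + E₀)) =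
      σ ^ 2 * ((M : ℝ) * (Δ / M)) * Sr * (6 * m * (‖w₁‖ ^ 2 + ‖w₂‖ ^ 2) + E₀) by ring, mul_div_cancel₀ _ hM']

end Arithmetic

/-! ## The Maxwellian second moment -/

section Gaussian

/-- `∫ (α + β ‖w‖²) dγ(w) = α + 3β` for the standard Maxwellian on `ℝ³` (`E‖w‖² = 3`). [folklore] -/
theorem lintegral_stdGaussian_const_add_mul_norm_sq {α β : ℝ} (hα : 0 ≤ α) (hβ : 0 ≤ β) :
    ∫⁻ w, ENNReal.ofReal (α + β * ‖w‖ ^ 2) ∂stdGaussian V3 = ENNReal.ofReal (α + 3 * β) := by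
  have h3 : ∫⁻ w, ENNReal.ofReal (‖w‖ ^ 2) ∂stdGaussian V3 = 3 := by
    rw [← ofReal_integral_eq_lintegral_ofReal integrable_norm_sq_stdGaussian
      (Eventually.of_forall fun w => sq_nonneg _), integral_norm_sq_stdGaussian]
    simp
  calc ∫⁻ w, ENNReal.ofReal (α + β * ‖w‖ ^ 2) ∂stdGaussian V3
      = ∫⁻ w, (ENNReal.ofReal α + ENNReal.ofReal β * ENNReal.ofReal (‖w‖ ^ 2)) ∂stdGaussian V3 :=
        lintegral_congr fun w => by rw [ENNReal.ofReal_add hα (by positivity), ENNReal.ofReal_mul hβ]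
    _ = ENNReal.ofReal α + ENNReal.ofReal β * 3 := by
        rw [lintegral_add_left measurable_const, lintegral_const, measure_univ, mul_one,
          lintegral_const_mul' _ _ ENNReal.ofReal_ne_top, h3]
    _ = ENNReal.ofReal (α + 3 * β) := by
        rw [ENNReal.ofReal_add hα (by positivity), mul_comm (3 : ℝ) β, ENNReal.ofReal_mul hβ, ENNReal.ofReal_ofNat]

end Gaussian

/-! ## The two-body majorant of a tagged pair of the cell law -/

section Mean

variable {σ : ℝ} {m : ℕ}

/-- **Positions out, energy in.** For a good bath datum `zb` of the `m`-sphere flow, the integral of the two-body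
majorant over the two tagged positions (uniform on the cube) is
`≤ L⁻⁶ σ⁴ Δ² |S²|² (6 m (‖w₁‖² + ‖w₂‖²) + ∑_c ‖v_c‖²)`: the static piece, then conservation of the kinetic energy of
the bath along its flow at every grid time (the mesh `Δ/M` cancels against the `M` grid times). [cite: CIP1994, §2.2] -/
theorem lintegral_pos_twoBodyMajorant_le (hσ : 0 < σ) (Ψ : Flows σ) {L Δ : ℝ} (hL : 0 < L) (hΔ : 0 < Δ) (M : ℕ)
    {zb : Cell m} (hzb : zb ∈ (Ψ m).good) (w₁ w₂ : V3) :
    ∫⁻ y₂, ∫⁻ y₁,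
        {p : V3 × V3 | PairHits σ p.1 p.2 ∧ 0 < pairDisc σ p.1 p.2 ∧ pairHitTime σ p.1 p.2 ∈ Set.Ioc 0 Δ}.indicator
              (1 : V3 × V3 → ℝ≥0∞) ((y₁ - y₂), (w₁ - w₂)) * ∑ ℓ ∈ Finset.range M, ∑ c : Fin m, ({p : V3 × V3 |
              PairHits σ p.1 p.2 ∧ 0 < pairDisc σ p.1 p.2 ∧ pairHitTime σ p.1 p.2 ∈ Set.Ioc 0 (Δ / M)}.indicator (1 :
              V3 × V3 → ℝ≥0∞) (y₁ + pairHitTime σ (y₁ - y₂) (w₁ - w₂) • w₁ + (((ℓ : ℝ) * (Δ / M)) - pairHitTime σ (y₁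
              - y₂) (w₁ - w₂)) • (reflectVel ((y₁ - y₂) + pairHitTime σ (y₁ - y₂) (w₁ - w₂) • (w₁ - w₂)) (w₁, w₂)).1
              - ((Ψ m).flow ((ℓ : ℝ) * (Δ / M)) zb c).1, (reflectVel ((y₁ - y₂) + pairHitTime σ (y₁ - y₂) (w₁ - w₂) •
              (w₁ - w₂)) (w₁, w₂)).1 - ((Ψ m).flow ((ℓ : ℝ) * (Δ / M)) zb c).2) + {p : V3 × V3 | PairHits σ p.1 p.2 ∧
              0 < pairDisc σ p.1 p.2 ∧ pairHitTime σ p.1 p.2 ∈ Set.Ioc 0 (Δ / M)}.indicator (1 : V3 × V3 → ℝ≥0∞) (y₂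
              + pairHitTime σ (y₁ - y₂) (w₁ - w₂) • w₂ + (((ℓ : ℝ) * (Δ / M)) - pairHitTime σ (y₁ - y₂) (w₁ - w₂)) •
              (reflectVel ((y₁ - y₂) + pairHitTime σ (y₁ - y₂) (w₁ - w₂) • (w₁ - w₂)) (w₁, w₂)).2 - ((Ψ m).flow ((ℓ :
              ℝ) * (Δ / M)) zb c).1, (reflectVel ((y₁ - y₂) + pairHitTime σ (y₁ - y₂) (w₁ - w₂) • (w₁ - w₂)) (w₁,
              w₂)).2 - ((Ψ m).flow ((ℓ : ℝ) * (Δ / M)) zb c).2))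
      ∂(volume[|cellCube L]) ∂(volume[|cellCube L]) ≤
      ENNReal.ofReal ((L ^ 3)⁻¹ * (L ^ 3)⁻¹ * (σ ^ 4 * Δ ^ 2 * (sphereMeasure (Set.univ : Set (Metric.sphere (0 : V3)
            1))).toReal ^ 2) *
        (6 * m * (‖w₁‖ ^ 2 + ‖w₂‖ ^ 2) + ∑ c : Fin m, ‖(zb c).2‖ ^ 2)) := by
  have hh : 0 ≤ Δ / M := div_nonneg hΔ.le (Nat.cast_nonneg M)
  have hstat := stub_clusterTail_freshPairHit_static σ L Δ (Δ / M) M m (fun ℓ => (ℓ : ℝ) * (Δ / M))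
    (fun ℓ c => ((Ψ m).flow ((ℓ : ℝ) * (Δ / M)) zb c).1) (fun ℓ c => ((Ψ m).flow ((ℓ : ℝ) * (Δ / M)) zb c).2)
    w₁ w₂ hσ hL hΔ.le hh
  refine hstat.trans (ENNReal.ofReal_le_ofReal ?_)
  have hSr : 0 ≤ (sphereMeasure (Set.univ : Set (Metric.sphere (0 : V3) 1))).toReal := ENNReal.toReal_nonneg
  -- energy conservation of the bath at the grid times
  have hE : ∀ ℓ ∈ Finset.range M, ∑ c : Fin m, ‖((Ψ m).flow ((ℓ : ℝ) * (Δ / M)) zb c).2‖ ^ 2 =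
      ∑ c : Fin m, ‖(zb c).2‖ ^ 2 := by
    intro ℓ hℓ
    have hℓM : (ℓ : ℝ) < M := by exact_mod_cast Finset.mem_range.1 hℓ
    have hM : (0 : ℝ) < M := lt_of_le_of_lt (Nat.cast_nonneg ℓ) hℓM
    have ht : (ℓ : ℝ) * (Δ / M) ∈ Set.Icc 0 Δ := by
      refine ⟨by positivity, ?_⟩
      rw [mul_div_assoc', div_le_iff₀ hM]
      nlinarith
    exact (stub_kinematicAssembly_clusterEnergy σ m Ψ zb hzb Finset.univ Δ
      (fun t _ p q _ _ => iff_of_true (Finset.mem_univ p) (Finset.mem_univ q)) _ ht).1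
  have key := pair_sum_energy_le (σ := σ) hΔ.le hSr (Finset.sum_nonneg fun c _ => sq_nonneg ‖(zb c).2‖) M
    (fun ℓ c => ((Ψ m).flow ((ℓ : ℝ) * (Δ / M)) zb c).2) w₁ w₂ hE
  have hK : 0 ≤ (L ^ 3)⁻¹ * (L ^ 3)⁻¹ * (σ ^ 2 * Δ * (sphereMeasure (Set.univ : Set (Metric.sphere (0 : V3)
        1))).toReal) := by positivity
  calc (L ^ 3)⁻¹ * (L ^ 3)⁻¹ * (σ ^ 2 * Δ * (‖w₁‖ + ‖w₂‖) * (sphereMeasure (Set.univ : Set (Metric.sphere (0 : V3)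
        1))).toReal *
        ∑ ℓ ∈ Finset.range M, ∑ c : Fin m,
          2 * (σ ^ 2 * (Δ / M) * (‖w₁‖ + ‖w₂‖ + ‖((Ψ m).flow ((ℓ : ℝ) * (Δ / M)) zb c).2‖) * (sphereMeasure (Set.univ
                : Set (Metric.sphere (0 : V3) 1))).toReal))
      = (L ^ 3)⁻¹ * (L ^ 3)⁻¹ * (σ ^ 2 * Δ * (sphereMeasure (Set.univ : Set (Metric.sphere (0 : V3) 1))).toReal) *
            ((‖w₁‖ + ‖w₂‖) *
        ∑ ℓ ∈ Finset.range M, ∑ c : Fin m,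
          2 * (σ ^ 2 * (Δ / M) * (‖w₁‖ + ‖w₂‖ + ‖((Ψ m).flow ((ℓ : ℝ) * (Δ / M)) zb c).2‖) * (sphereMeasure (Set.univ
                : Set (Metric.sphere (0 : V3) 1))).toReal)) := by ring
    _ ≤ (L ^ 3)⁻¹ * (L ^ 3)⁻¹ * (σ ^ 2 * Δ * (sphereMeasure (Set.univ : Set (Metric.sphere (0 : V3) 1))).toReal) *
        (σ ^ 2 * Δ * (sphereMeasure (Set.univ : Set (Metric.sphere (0 : V3) 1))).toReal * (6 * m * (‖w₁‖ ^ 2 + ‖w₂‖ ^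
              2) + ∑ c : Fin m, ‖(zb c).2‖ ^ 2)) :=
      mul_le_mul_of_nonneg_left key hK
    _ = _ := by ring

/-- **The bath average.** Integrating the previous bound against the `m`-sphere cell law (a probability measure for
`m ≤ 2L³`, mean kinetic energy `≤ 3m`): `≤ L⁻⁶ σ⁴ Δ² |S²|² (6 m (‖w₁‖² + ‖w₂‖²) + 3 m)`. [folklore] -/
theorem lintegral_bath_twoBodyMajorant_le (hσ : 0 < σ) (hσ' : σ ≤ 3 / 16) (hfac : CellLawFactorises σ) (Ψ : Flows σ)
    {L Δ : ℝ} (hL : 1 ≤ L) (hm : (m : ℝ) ≤ 2 * L ^ 3) (hΔ : 0 < Δ) (M : ℕ) (w₁ w₂ : V3) :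
    ∫⁻ zb, ∫⁻ y₂, ∫⁻ y₁,
        {p : V3 × V3 | PairHits σ p.1 p.2 ∧ 0 < pairDisc σ p.1 p.2 ∧ pairHitTime σ p.1 p.2 ∈ Set.Ioc 0 Δ}.indicator
              (1 : V3 × V3 → ℝ≥0∞) ((y₁ - y₂), (w₁ - w₂)) * ∑ ℓ ∈ Finset.range M, ∑ c : Fin m, ({p : V3 × V3 |
              PairHits σ p.1 p.2 ∧ 0 < pairDisc σ p.1 p.2 ∧ pairHitTime σ p.1 p.2 ∈ Set.Ioc 0 (Δ / M)}.indicator (1 :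
              V3 × V3 → ℝ≥0∞) (y₁ + pairHitTime σ (y₁ - y₂) (w₁ - w₂) • w₁ + (((ℓ : ℝ) * (Δ / M)) - pairHitTime σ (y₁
              - y₂) (w₁ - w₂)) • (reflectVel ((y₁ - y₂) + pairHitTime σ (y₁ - y₂) (w₁ - w₂) • (w₁ - w₂)) (w₁, w₂)).1
              - ((Ψ m).flow ((ℓ : ℝ) * (Δ / M)) zb c).1, (reflectVel ((y₁ - y₂) + pairHitTime σ (y₁ - y₂) (w₁ - w₂) •
              (w₁ - w₂)) (w₁, w₂)).1 - ((Ψ m).flow ((ℓ : ℝ) * (Δ / M)) zb c).2) + {p : V3 × V3 | PairHits σ p.1 p.2 ∧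
              0 < pairDisc σ p.1 p.2 ∧ pairHitTime σ p.1 p.2 ∈ Set.Ioc 0 (Δ / M)}.indicator (1 : V3 × V3 → ℝ≥0∞) (y₂
              + pairHitTime σ (y₁ - y₂) (w₁ - w₂) • w₂ + (((ℓ : ℝ) * (Δ / M)) - pairHitTime σ (y₁ - y₂) (w₁ - w₂)) •
              (reflectVel ((y₁ - y₂) + pairHitTime σ (y₁ - y₂) (w₁ - w₂) • (w₁ - w₂)) (w₁, w₂)).2 - ((Ψ m).flow ((ℓ :
              ℝ) * (Δ / M)) zb c).1, (reflectVel ((y₁ - y₂) + pairHitTime σ (y₁ - y₂) (w₁ - w₂) • (w₁ - w₂)) (w₁,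
              w₂)).2 - ((Ψ m).flow ((ℓ : ℝ) * (Δ / M)) zb c).2))
      ∂(volume[|cellCube L]) ∂(volume[|cellCube L]) ∂(cellLaw σ L m Ψ) ≤
      ENNReal.ofReal ((L ^ 3)⁻¹ * (L ^ 3)⁻¹ * (σ ^ 4 * Δ ^ 2 * (sphereMeasure (Set.univ : Set (Metric.sphere (0 : V3)
            1))).toReal ^ 2) *
        (6 * m * (‖w₁‖ ^ 2 + ‖w₂‖ ^ 2) + 3 * m)) := by
  have hL0 : 0 < L := one_pos.trans_le hL
  haveI : IsProbabilityMeasure (cellLaw σ L m Ψ) := isProbabilityMeasure_cellLaw hσ' hL hm (Ψ m)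
  haveI := isProbabilityMeasure_posLaw (posZ_ne_zero hσ' hL hm)
  set K : ℝ := (L ^ 3)⁻¹ * (L ^ 3)⁻¹ * (σ ^ 4 * Δ ^ 2 * (sphereMeasure (Set.univ : Set (Metric.sphere (0 : V3)
        1))).toReal ^ 2) with hKdef
  have hK : 0 ≤ K := by positivity
  set A : ℝ := 6 * m * (‖w₁‖ ^ 2 + ‖w₂‖ ^ 2) with hAdef
  have hA : 0 ≤ A := by positivity
  have hkin : ∫⁻ zb : Cell m, ENNReal.ofReal (∑ c : Fin m, ‖(zb c).2‖ ^ 2) ∂(cellLaw σ L m Ψ) ≤ 3 * m := by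
    have heq : (fun zb : Cell m => ENNReal.ofReal (∑ c : Fin m, ‖(zb c).2‖ ^ 2)) =
        fun zb => ∑ c : Fin m, ENNReal.ofReal (‖(zb c).2‖ ^ 2) :=
      funext fun zb => ENNReal.ofReal_sum_of_nonneg fun c _ => sq_nonneg _
    rw [heq]
    exact lintegral_kinetic_cellLaw_le hfac L m Ψ prob_le_one
  calc ∫⁻ zb, ∫⁻ y₂, ∫⁻ y₁,
          {p : V3 × V3 | PairHits σ p.1 p.2 ∧ 0 < pairDisc σ p.1 p.2 ∧ pairHitTime σ p.1 p.2 ∈ Set.Ioc 0 Δ}.indicator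
                (1 : V3 × V3 → ℝ≥0∞) ((y₁ - y₂), (w₁ - w₂)) * ∑ ℓ ∈ Finset.range M, ∑ c : Fin m, ({p : V3 × V3 |
                PairHits σ p.1 p.2 ∧ 0 < pairDisc σ p.1 p.2 ∧ pairHitTime σ p.1 p.2 ∈ Set.Ioc 0 (Δ / M)}.indicator (1
                : V3 × V3 → ℝ≥0∞) (y₁ + pairHitTime σ (y₁ - y₂) (w₁ - w₂) • w₁ + (((ℓ : ℝ) * (Δ / M)) - pairHitTime σ
                (y₁ - y₂) (w₁ - w₂)) • (reflectVel ((y₁ - y₂) + pairHitTime σ (y₁ - y₂) (w₁ - w₂) • (w₁ - w₂)) (w₁,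
                w₂)).1 - ((Ψ m).flow ((ℓ : ℝ) * (Δ / M)) zb c).1, (reflectVel ((y₁ - y₂) + pairHitTime σ (y₁ - y₂)
                (w₁ - w₂) • (w₁ - w₂)) (w₁, w₂)).1 - ((Ψ m).flow ((ℓ : ℝ) * (Δ / M)) zb c).2) + {p : V3 × V3 |
                PairHits σ p.1 p.2 ∧ 0 < pairDisc σ p.1 p.2 ∧ pairHitTime σ p.1 p.2 ∈ Set.Ioc 0 (Δ / M)}.indicator (1
                : V3 × V3 → ℝ≥0∞) (y₂ + pairHitTime σ (y₁ - y₂) (w₁ - w₂) • w₂ + (((ℓ : ℝ) * (Δ / M)) - pairHitTime σ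
                (y₁ - y₂) (w₁ - w₂)) • (reflectVel ((y₁ - y₂) + pairHitTime σ (y₁ - y₂) (w₁ - w₂) • (w₁ - w₂)) (w₁,
                w₂)).2 - ((Ψ m).flow ((ℓ : ℝ) * (Δ / M)) zb c).1, (reflectVel ((y₁ - y₂) + pairHitTime σ (y₁ - y₂)
                (w₁ - w₂) • (w₁ - w₂)) (w₁, w₂)).2 - ((Ψ m).flow ((ℓ : ℝ) * (Δ / M)) zb c).2))
        ∂(volume[|cellCube L]) ∂(volume[|cellCube L]) ∂(cellLaw σ L m Ψ)
      ≤ ∫⁻ zb, ENNReal.ofReal (K * (A + ∑ c : Fin m, ‖(zb c).2‖ ^ 2)) ∂(cellLaw σ L m Ψ) := by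
        refine lintegral_mono_ae ?_
        filter_upwards [ae_mem_good_cellLaw σ L m Ψ] with zb hzb
        exact lintegral_pos_twoBodyMajorant_le hσ Ψ hL0 hΔ M hzb w₁ w₂
    _ = ∫⁻ zb, (ENNReal.ofReal (K * A) + ENNReal.ofReal K * ENNReal.ofReal (∑ c : Fin m, ‖(zb c).2‖ ^ 2))
          ∂(cellLaw σ L m Ψ) := by
        refine lintegral_congr fun zb => ?_
        rw [mul_add, ENNReal.ofReal_add (by positivity) (by positivity)]
        congr 1
        exact ENNReal.ofReal_mul hK
    _ = ENNReal.ofReal (K * A) + ENNReal.ofReal K * ∫⁻ zb, ENNReal.ofReal (∑ c : Fin m, ‖(zb c).2‖ ^ 2)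
          ∂(cellLaw σ L m Ψ) := by
        rw [lintegral_add_left measurable_const, lintegral_const, measure_univ, mul_one,
          lintegral_const_mul' _ _ ENNReal.ofReal_ne_top]
    _ ≤ ENNReal.ofReal (K * A) + ENNReal.ofReal K * (3 * m) := add_le_add le_rfl (mul_le_mul' le_rfl hkin)
    _ = ENNReal.ofReal (K * (A + 3 * m)) := by
        rw [mul_add, ENNReal.ofReal_add (by positivity) (by positivity)]
        congr 1
        rw [ENNReal.ofReal_mul hK, ENNReal.ofReal_mul zero_le_three, ENNReal.ofReal_ofNat, ENNReal.ofReal_natCast]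

/-- The two-body majorant of a tagged ordered pair `(i, i.succAbove j')` is a measurable function of the datum of
the `(m+2)`-sphere cell (the bath enters through the measurable time-`ℓΔ/M` maps of the `m`-sphere flow). [folklore] -/
theorem measurable_pairMajorant (σ Δ : ℝ) (M : ℕ) (Ψ : Flows σ) (i : Fin (m + 2)) (j' : Fin (m + 1)) :
    Measurable fun z : Cell (m + 2) =>
      {p : V3 × V3 | PairHits σ p.1 p.2 ∧ 0 < pairDisc σ p.1 p.2 ∧ pairHitTime σ p.1 p.2 ∈ Set.Ioc 0 Δ}.indicator (1
            : V3 × V3 → ℝ≥0∞) (((z i).1 - (z (i.succAbove j')).1), ((z i).2 - (z (i.succAbove j')).2)) * ∑ ℓ ∈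
            Finset.range M, ∑ c : Fin m, ({p : V3 × V3 | PairHits σ p.1 p.2 ∧ 0 < pairDisc σ p.1 p.2 ∧ pairHitTime σ
            p.1 p.2 ∈ Set.Ioc 0 (Δ / M)}.indicator (1 : V3 × V3 → ℝ≥0∞) ((z i).1 + pairHitTime σ ((z i).1 - (z
            (i.succAbove j')).1) ((z i).2 - (z (i.succAbove j')).2) • (z i).2 + (((ℓ : ℝ) * (Δ / M)) - pairHitTime σ
            ((z i).1 - (z (i.succAbove j')).1) ((z i).2 - (z (i.succAbove j')).2)) • (reflectVel (((z i).1 - (z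
            (i.succAbove j')).1) + pairHitTime σ ((z i).1 - (z (i.succAbove j')).1) ((z i).2 - (z (i.succAbove
            j')).2) • ((z i).2 - (z (i.succAbove j')).2)) ((z i).2, (z (i.succAbove j')).2)).1 - ((Ψ m).flow ((ℓ : ℝ)
            * (Δ / M)) (fun c => z (i.succAbove (j'.succAbove c))) c).1, (reflectVel (((z i).1 - (z (i.succAbove
            j')).1) + pairHitTime σ ((z i).1 - (z (i.succAbove j')).1) ((z i).2 - (z (i.succAbove j')).2) • ((z i).2
            - (z (i.succAbove j')).2)) ((z i).2, (z (i.succAbove j')).2)).1 - ((Ψ m).flow ((ℓ : ℝ) * (Δ / M)) (fun c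
            => z (i.succAbove (j'.succAbove c))) c).2) + {p : V3 × V3 | PairHits σ p.1 p.2 ∧ 0 < pairDisc σ p.1 p.2 ∧
            pairHitTime σ p.1 p.2 ∈ Set.Ioc 0 (Δ / M)}.indicator (1 : V3 × V3 → ℝ≥0∞) ((z (i.succAbove j')).1 +
            pairHitTime σ ((z i).1 - (z (i.succAbove j')).1) ((z i).2 - (z (i.succAbove j')).2) • (z (i.succAbove
            j')).2 + (((ℓ : ℝ) * (Δ / M)) - pairHitTime σ ((z i).1 - (z (i.succAbove j')).1) ((z i).2 - (z
            (i.succAbove j')).2)) • (reflectVel (((z i).1 - (z (i.succAbove j')).1) + pairHitTime σ ((z i).1 - (z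
            (i.succAbove j')).1) ((z i).2 - (z (i.succAbove j')).2) • ((z i).2 - (z (i.succAbove j')).2)) ((z i).2,
            (z (i.succAbove j')).2)).2 - ((Ψ m).flow ((ℓ : ℝ) * (Δ / M)) (fun c => z (i.succAbove (j'.succAbove c)))
            c).1, (reflectVel (((z i).1 - (z (i.succAbove j')).1) + pairHitTime σ ((z i).1 - (z (i.succAbove j')).1)
            ((z i).2 - (z (i.succAbove j')).2) • ((z i).2 - (z (i.succAbove j')).2)) ((z i).2, (z (i.succAbove
            j')).2)).2 - ((Ψ m).flow ((ℓ : ℝ) * (Δ / M)) (fun c => z (i.succAbove (j'.succAbove c))) c).2)) := by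
  have hB : ∀ ℓ : ℕ, Measurable fun z : Cell (m + 2) =>
      (Ψ m).flow ((ℓ : ℝ) * (Δ / M)) (fun c => z (i.succAbove (j'.succAbove c))) :=
    fun ℓ => ((Ψ m).measurable_flow _).comp (measurable_pi_lambda _ fun c => measurable_pi_apply _)
  have hπ : Measurable fun z : Cell (m + 2) => (((z i, z (i.succAbove j')) : (V3 × V3) × (V3 × V3)), z) :=
    ((measurable_pi_apply i).prodMk (measurable_pi_apply _)).prodMk measurable_id
  exact ((measurable_twoBodyMajorant σ Δ (Δ / M) (fun ℓ => (ℓ : ℝ) * (Δ / M)) M m hB).comp hπ :)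

/-! ## The registered sub-goal: double insertion -/

/-- **Registered sub-goal `stub_clusterTail_freshPairHit_mean`** (piece of the registered sub-goal
`stub_clusterTail_freshPairHit`, S2e-3, of stub `stub_clusterTail` of the line `enskog-compensator-martingale`):
**the mean of the two-body majorant of a tagged ordered pair under the cell law.** For `0 < σ ≤ 3/16`, `L ≥ 1`,
`m + 2 ≤ 2L³`, `Δ > 0`, every mesh `Δ/M`, every cluster dynamics and every tagged ordered pair `(i, i.succAbove j')`
of the `(m+2)`-sphere cell law, the majorant of the pathwise piece — cylinder indicator of the pair's initial relative
data times the number of triples (grid time `ℓΔ/M`, bath sphere `c`, tag) whose explicit two-body state of the tag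
relative to the time-`ℓΔ/M` state of the sphere `c` of the `m`-sphere flow of the bath lies in the cylinder of length
`Δ/M` — has mean `≤ 156 |S²|² σ⁴ m Δ² L⁻⁶` (double insertion, positions out by the static piece, energy of the bath,
Maxwellian moments). [cite: CIP1994, §2.2] -/
theorem stub_clusterTail_freshPairHit_mean : ∀ (σ L Δ : ℝ) (m M : ℕ) (Ψ : Flows σ) (i : Fin (m + 2)) (j' : Fin (m +
      1)),
    0 < σ → σ ≤ 3 / 16 → CellLawFactorises σ → 1 ≤ L → ((m + 2 : ℕ) : ℝ) ≤ 2 * L ^ 3 → 0 < Δ →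
    ∫⁻ z,
        {p : V3 × V3 | PairHits σ p.1 p.2 ∧ 0 < pairDisc σ p.1 p.2 ∧ pairHitTime σ p.1 p.2 ∈ Set.Ioc 0 Δ}.indicator
              (1 : V3 × V3 → ℝ≥0∞) (((z i).1 - (z (i.succAbove j')).1), ((z i).2 - (z (i.succAbove j')).2)) * ∑ ℓ ∈
              Finset.range M, ∑ c : Fin m, ({p : V3 × V3 | PairHits σ p.1 p.2 ∧ 0 < pairDisc σ p.1 p.2 ∧ pairHitTime
              σ p.1 p.2 ∈ Set.Ioc 0 (Δ / M)}.indicator (1 : V3 × V3 → ℝ≥0∞) ((z i).1 + pairHitTime σ ((z i).1 - (z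
              (i.succAbove j')).1) ((z i).2 - (z (i.succAbove j')).2) • (z i).2 + (((ℓ : ℝ) * (Δ / M)) - pairHitTime
              σ ((z i).1 - (z (i.succAbove j')).1) ((z i).2 - (z (i.succAbove j')).2)) • (reflectVel (((z i).1 - (z
              (i.succAbove j')).1) + pairHitTime σ ((z i).1 - (z (i.succAbove j')).1) ((z i).2 - (z (i.succAbove
              j')).2) • ((z i).2 - (z (i.succAbove j')).2)) ((z i).2, (z (i.succAbove j')).2)).1 - ((Ψ m).flow ((ℓ :
              ℝ) * (Δ / M)) (fun c => z (i.succAbove (j'.succAbove c))) c).1, (reflectVel (((z i).1 - (z (i.succAbove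
              j')).1) + pairHitTime σ ((z i).1 - (z (i.succAbove j')).1) ((z i).2 - (z (i.succAbove j')).2) • ((z
              i).2 - (z (i.succAbove j')).2)) ((z i).2, (z (i.succAbove j')).2)).1 - ((Ψ m).flow ((ℓ : ℝ) * (Δ / M))
              (fun c => z (i.succAbove (j'.succAbove c))) c).2) + {p : V3 × V3 | PairHits σ p.1 p.2 ∧ 0 < pairDisc σ
              p.1 p.2 ∧ pairHitTime σ p.1 p.2 ∈ Set.Ioc 0 (Δ / M)}.indicator (1 : V3 × V3 → ℝ≥0∞) ((z (i.succAbove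
              j')).1 + pairHitTime σ ((z i).1 - (z (i.succAbove j')).1) ((z i).2 - (z (i.succAbove j')).2) • (z
              (i.succAbove j')).2 + (((ℓ : ℝ) * (Δ / M)) - pairHitTime σ ((z i).1 - (z (i.succAbove j')).1) ((z i).2
              - (z (i.succAbove j')).2)) • (reflectVel (((z i).1 - (z (i.succAbove j')).1) + pairHitTime σ ((z i).1 -
              (z (i.succAbove j')).1) ((z i).2 - (z (i.succAbove j')).2) • ((z i).2 - (z (i.succAbove j')).2)) ((z
              i).2, (z (i.succAbove j')).2)).2 - ((Ψ m).flow ((ℓ : ℝ) * (Δ / M)) (fun c => z (i.succAbove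
              (j'.succAbove c))) c).1, (reflectVel (((z i).1 - (z (i.succAbove j')).1) + pairHitTime σ ((z i).1 - (z
              (i.succAbove j')).1) ((z i).2 - (z (i.succAbove j')).2) • ((z i).2 - (z (i.succAbove j')).2)) ((z i).2,
              (z (i.succAbove j')).2)).2 - ((Ψ m).flow ((ℓ : ℝ) * (Δ / M)) (fun c => z (i.succAbove (j'.succAbove
              c))) c).2))
      ∂(cellLaw σ L (m + 2) Ψ) ≤
      ENNReal.ofReal (156 * (sphereMeasure (Set.univ : Set (Metric.sphere (0 : V3) 1))).toReal ^ 2 * σ ^ 4 * m * Δ ^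
            2 * ((L ^ 3)⁻¹ * (L ^ 3)⁻¹)) := by
  intro σ L Δ m M Ψ i j' hσ hσ' hfac hL hm hΔ
  have hm1 : ((m + 1 : ℕ) : ℝ) ≤ 2 * L ^ 3 := le_trans (by exact_mod_cast Nat.le_succ (m + 1)) hm
  have hm0 : (m : ℝ) ≤ 2 * L ^ 3 := le_trans (by exact_mod_cast Nat.le_succ m) hm1
  set Sr : ℝ := (sphereMeasure (Set.univ : Set (Metric.sphere (0 : V3) 1))).toReal with hSr
  set K : ℝ := (L ^ 3)⁻¹ * (L ^ 3)⁻¹ * (σ ^ 4 * Δ ^ 2 * Sr ^ 2) with hKdef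
  have hK : 0 ≤ K := by positivity
  -- the majorant as a function of the full datum
  set F : Cell (m + 2) → ℝ≥0∞ := fun z =>
    {p : V3 × V3 | PairHits σ p.1 p.2 ∧ 0 < pairDisc σ p.1 p.2 ∧ pairHitTime σ p.1 p.2 ∈ Set.Ioc 0 Δ}.indicator (1 :
          V3 × V3 → ℝ≥0∞) (((z i).1 - (z (i.succAbove j')).1), ((z i).2 - (z (i.succAbove j')).2)) * ∑ ℓ ∈
          Finset.range M, ∑ c : Fin m, ({p : V3 × V3 | PairHits σ p.1 p.2 ∧ 0 < pairDisc σ p.1 p.2 ∧ pairHitTime σ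
          p.1 p.2 ∈ Set.Ioc 0 (Δ / M)}.indicator (1 : V3 × V3 → ℝ≥0∞) ((z i).1 + pairHitTime σ ((z i).1 - (z
          (i.succAbove j')).1) ((z i).2 - (z (i.succAbove j')).2) • (z i).2 + (((ℓ : ℝ) * (Δ / M)) - pairHitTime σ
          ((z i).1 - (z (i.succAbove j')).1) ((z i).2 - (z (i.succAbove j')).2)) • (reflectVel (((z i).1 - (z
          (i.succAbove j')).1) + pairHitTime σ ((z i).1 - (z (i.succAbove j')).1) ((z i).2 - (z (i.succAbove j')).2)
          • ((z i).2 - (z (i.succAbove j')).2)) ((z i).2, (z (i.succAbove j')).2)).1 - ((Ψ m).flow ((ℓ : ℝ) * (Δ /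
          M)) (fun c => z (i.succAbove (j'.succAbove c))) c).1, (reflectVel (((z i).1 - (z (i.succAbove j')).1) +
          pairHitTime σ ((z i).1 - (z (i.succAbove j')).1) ((z i).2 - (z (i.succAbove j')).2) • ((z i).2 - (z
          (i.succAbove j')).2)) ((z i).2, (z (i.succAbove j')).2)).1 - ((Ψ m).flow ((ℓ : ℝ) * (Δ / M)) (fun c => z
          (i.succAbove (j'.succAbove c))) c).2) + {p : V3 × V3 | PairHits σ p.1 p.2 ∧ 0 < pairDisc σ p.1 p.2 ∧
          pairHitTime σ p.1 p.2 ∈ Set.Ioc 0 (Δ / M)}.indicator (1 : V3 × V3 → ℝ≥0∞) ((z (i.succAbove j')).1 +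
          pairHitTime σ ((z i).1 - (z (i.succAbove j')).1) ((z i).2 - (z (i.succAbove j')).2) • (z (i.succAbove
          j')).2 + (((ℓ : ℝ) * (Δ / M)) - pairHitTime σ ((z i).1 - (z (i.succAbove j')).1) ((z i).2 - (z (i.succAbove
          j')).2)) • (reflectVel (((z i).1 - (z (i.succAbove j')).1) + pairHitTime σ ((z i).1 - (z (i.succAbove
          j')).1) ((z i).2 - (z (i.succAbove j')).2) • ((z i).2 - (z (i.succAbove j')).2)) ((z i).2, (z (i.succAbove
          j')).2)).2 - ((Ψ m).flow ((ℓ : ℝ) * (Δ / M)) (fun c => z (i.succAbove (j'.succAbove c))) c).1, (reflectVel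
          (((z i).1 - (z (i.succAbove j')).1) + pairHitTime σ ((z i).1 - (z (i.succAbove j')).1) ((z i).2 - (z
          (i.succAbove j')).2) • ((z i).2 - (z (i.succAbove j')).2)) ((z i).2, (z (i.succAbove j')).2)).2 - ((Ψ
          m).flow ((ℓ : ℝ) * (Δ / M)) (fun c => z (i.succAbove (j'.succAbove c))) c).2)) with hFdef
  have hF : Measurable F := measurable_pairMajorant σ Δ M Ψ i j'
  have hins : Measurable fun p : (V3 × V3) × Cell (m + 1) => (Fin.insertNth i p.1 p.2 : Cell (m + 2)) :=
    (MeasurableEquiv.piFinSuccAbove (fun _ : Fin (m + 2) => V3 × V3) i).symm.measurable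
  have hF2 : ∀ w₁ : V3, Measurable fun z' : Cell (m + 1) =>
      ∫⁻ y₁, F (Fin.insertNth i (y₁, w₁) z') ∂(volume[|cellCube L]) := fun w₁ => by
    refine Measurable.lintegral_prod_right' (f := fun q : Cell (m + 1) × V3 => F (Fin.insertNth i (q.2, w₁) q.1)) ?_
    exact hF.comp (hins.comp ((measurable_snd.prodMk measurable_const).prodMk measurable_fst))
  change ∫⁻ z, F z ∂(cellLaw σ L (m + 2) Ψ) ≤ _
  -- first insertion: the tag `i`
  refine (lintegral_cellLaw_succ_le hσ hσ' hfac hL hm Ψ i hF).trans ?_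
  -- second insertion: the tag `i.succAbove j'`, i.e. the label `j'` of the remaining `m + 1` spheres
  have h2 : ∀ w₁ : V3, ∫⁻ z', ∫⁻ y₁, F (Fin.insertNth i (y₁, w₁) z') ∂(volume[|cellCube L]) ∂(cellLaw σ L (m + 1) Ψ) ≤
      2 * ∫⁻ w₂, ENNReal.ofReal (K * (6 * m * (‖w₁‖ ^ 2 + ‖w₂‖ ^ 2) + 3 * m)) ∂stdGaussian V3 := by
    intro w₁
    refine (lintegral_cellLaw_succ_le hσ hσ' hfac hL hm1 Ψ j' (hF2 w₁)).trans (mul_le_mul' le_rfl ?_)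
    refine lintegral_mono fun w₂ => ?_
    simp only [hFdef, Fin.insertNth_apply_same, Fin.insertNth_apply_succAbove]
    exact lintegral_bath_twoBodyMajorant_le hσ hσ' hfac Ψ hL hm0 hΔ M w₁ w₂
  -- the Maxwellian integrals
  have h3 : ∀ w₁ : V3, ∫⁻ w₂, ENNReal.ofReal (K * (6 * m * (‖w₁‖ ^ 2 + ‖w₂‖ ^ 2) + 3 * m)) ∂stdGaussian V3 =
      ENNReal.ofReal ((K * (3 * m) + 3 * (K * (6 * m))) + K * (6 * m) * ‖w₁‖ ^ 2) := by
    intro w₁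
    have := lintegral_stdGaussian_const_add_mul_norm_sq (α := K * (6 * m * ‖w₁‖ ^ 2 + 3 * m))
      (β := K * (6 * m)) (by positivity) (by positivity)
    calc ∫⁻ w₂, ENNReal.ofReal (K * (6 * m * (‖w₁‖ ^ 2 + ‖w₂‖ ^ 2) + 3 * m)) ∂stdGaussian V3
        = ∫⁻ w₂, ENNReal.ofReal (K * (6 * m * ‖w₁‖ ^ 2 + 3 * m) + K * (6 * m) * ‖w₂‖ ^ 2) ∂stdGaussian V3 :=
          lintegral_congr fun w₂ => by congr 1; ring
      _ = _ := by rw [this]; congr 1; ring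
  have h4 : ∫⁻ w₁, ENNReal.ofReal ((K * (3 * m) + 3 * (K * (6 * m))) + K * (6 * m) * ‖w₁‖ ^ 2) ∂stdGaussian V3 =
      ENNReal.ofReal (39 * m * K) := by
    rw [lintegral_stdGaussian_const_add_mul_norm_sq (by positivity) (by positivity)]
    congr 1; ring
  calc 2 * ∫⁻ w₁, ∫⁻ z', ∫⁻ y₁, F (Fin.insertNth i (y₁, w₁) z') ∂(volume[|cellCube L]) ∂(cellLaw σ L (m + 1) Ψ)
        ∂stdGaussian V3
      ≤ 2 * ∫⁻ w₁, 2 * ∫⁻ w₂, ENNReal.ofReal (K * (6 * m * (‖w₁‖ ^ 2 + ‖w₂‖ ^ 2) + 3 * m)) ∂stdGaussian V3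
          ∂stdGaussian V3 := mul_le_mul' le_rfl (lintegral_mono h2)
    _ = 2 * (2 * ENNReal.ofReal (39 * m * K)) := by
        simp only [h3]
        rw [lintegral_const_mul' _ _ ENNReal.ofNat_ne_top, h4]
    _ = ENNReal.ofReal (156 * Sr ^ 2 * σ ^ 4 * m * Δ ^ 2 * ((L ^ 3)⁻¹ * (L ^ 3)⁻¹)) := by
        rw [← mul_assoc, ← ENNReal.ofReal_ofNat 2, ← ENNReal.ofReal_mul zero_le_two,
          ← ENNReal.ofReal_mul (by positivity)]
        congr 1
        rw [hKdef]; ring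

end Mean

end Summit.AtomisticToContinuum.HydrodynamicLimit.Theorems.EnskogCompensator

end
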